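import Mathlib
import HarnessLib
import Literature.MathematicalPhysics.QuantumLattice.HubbardTwoPointMoments
import Summits.HubbardSuperconductivity.HubbardSuperconductivity.Theorems.KLProgrammeKLRegimeVolumeLimitTwoTimeDetMatch

/-!
# Child `KLRegimeVolumeLimitV12` (stmt-HubbardSuperconductivity-19858), `stub_vl_bound` via (H1), step C3d (first part): the Grassmann matrix
# of (H1) in `twoPointPlusEnum` indexing IS `twoTimeLimitMatrix`, and the Hamiltonian block data (`Fin.append`/`Fin.cons` form of
# `hasSum_hubbard_twoPoint_twoTime_renormalised_det`) IS the `Fin.insertNth` data of `twoTimeHamMatrix`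
# (seat hubbard-kl-k3c5-p1 g4; HOME/hubbard-kl-k3c5-p1/H1-DESIGN.md §5)

* `twoPointLimitMatrix_time_eq_twoTimeLimitMatrix` — for vertices `x : Fin n → 𝕋_L` with times `τ`, external `(x̄ₑ, σ; s)`, `(ȳₑ, σ′; 0)`:
  the matrix `[vertexLimitEntry (x′ (P i).1) (x′ (Q b).1) (P i).2 (Q b).2 (τ′ (Q b).1 − τ′ (P i).1)]` of (H1) (P/Q = `twoPointPlusEnum /
  twoPointMinusEnum`, `x′ = Fin.append x ![x̄ₑ, ȳₑ]`, `τ′ = Fin.append τ ![s, 0]`) equals `twoTimeLimitMatrix β μ y ς t x̄ₑ ȳₑ σ σ′ s` with the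
  pair data `y m = x (m/2)`, `ς m = m % 2`, `t m = τ (m/2)` (`finProdFinEquiv`);
* `append_cons_apply_succAbove` / `append_cons_apply_mid` — `Fin.append A (Fin.cons x B)` read at `K.succAbove m` and at `K` (`K = |A|`):
  the access identities turning the block data of the two-time Dyson series into `Fin.insertNth` data.
-/

noncomputable section

namespace Summit.HubbardSuperconductivity.HubbardSuperconductivity.Theorems.TwoPointAssembly

set_option linter.dupNamespace false -- summit = problem name (single-conjunct summit), D-0017

open Finset NormedSpace Matrix Literature.MathematicalPhysics.QuantumLattice Literature.Probability.LatticeModels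

variable {L : ℕ} [NeZero L]

/-- **The Grassmann matrix of (H1) is `twoTimeLimitMatrix` of the pair data** (pair `m` ↦ vertex `m/2`, spin `m%2`). -/
theorem twoPointLimitMatrix_time_eq_twoTimeLimitMatrix (β μ : ℝ) (σ σ' : Fin 2) (xe ye : TorusSite 2 L) {n : ℕ}
    (x : Fin n → TorusSite 2 L) (τ : Fin n → ℝ) (s : ℝ) :
    (Matrix.of fun i j : Fin (n * 2 + 1) =>
      vertexLimitEntry L β μ ((Fin.append x ![xe, ye] : Fin (n + 2) → TorusSite 2 L) (twoPointPlusEnum n σ i).1)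
        ((Fin.append x ![xe, ye] : Fin (n + 2) → TorusSite 2 L) (twoPointMinusEnum n σ' j).1)
        (twoPointPlusEnum n σ i).2 (twoPointMinusEnum n σ' j).2
        ((Fin.append τ ![s, (0 : ℝ)] : Fin (n + 2) → ℝ) (twoPointMinusEnum n σ' j).1 -
          (Fin.append τ ![s, (0 : ℝ)] : Fin (n + 2) → ℝ) (twoPointPlusEnum n σ i).1)) =
      twoTimeLimitMatrix β μ (fun m : Fin (n * 2) => x (finProdFinEquiv.symm m : Fin n × Fin 2).1)
        (fun m : Fin (n * 2) => (finProdFinEquiv.symm m : Fin n × Fin 2).2)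
        (fun m : Fin (n * 2) => τ (finProdFinEquiv.symm m : Fin n × Fin 2).1) xe ye σ σ' s := by
  have hx0 : (Fin.append x ![xe, ye] : Fin (n + 2) → TorusSite 2 L) (Fin.natAdd n 0) = xe := by
    simp only [Fin.append_right, Matrix.cons_val_zero]
  have hx1 : (Fin.append x ![xe, ye] : Fin (n + 2) → TorusSite 2 L) (Fin.natAdd n 1) = ye := by
    simp only [Fin.append_right, Matrix.cons_val_one, Matrix.cons_val_zero]
  have hxa : ∀ a, (Fin.append x ![xe, ye] : Fin (n + 2) → TorusSite 2 L) (Fin.castAdd 2 a) = x a := fun a => by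
    simp only [Fin.append_left]
  have ht0 : (Fin.append τ ![s, (0 : ℝ)] : Fin (n + 2) → ℝ) (Fin.natAdd n 0) = s := by
    simp only [Fin.append_right, Matrix.cons_val_zero]
  have ht1 : (Fin.append τ ![s, (0 : ℝ)] : Fin (n + 2) → ℝ) (Fin.natAdd n 1) = 0 := by
    simp only [Fin.append_right, Matrix.cons_val_one, Matrix.cons_val_zero]
  have hta : ∀ a, (Fin.append τ ![s, (0 : ℝ)] : Fin (n + 2) → ℝ) (Fin.castAdd 2 a) = τ a := fun a => by
    simp only [Fin.append_left]
  ext i j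
  rw [Matrix.of_apply, twoTimeLimitMatrix, Matrix.of_apply]
  refine Fin.cases ?_ (fun m => ?_) i <;> refine Fin.cases ?_ (fun m' => ?_) j
  · simp only [twoPointPlusEnum_zero, twoPointMinusEnum_zero, hx0, hx1, ht0, ht1, Fin.cons_zero]
  · simp only [twoPointPlusEnum_zero, twoPointMinusEnum_succ, hx0, hxa, ht0, hta, Fin.cons_zero, Fin.cons_succ]
  · simp only [twoPointPlusEnum_succ, twoPointMinusEnum_zero, hx1, hxa, ht1, hta, Fin.cons_zero, Fin.cons_succ]
  · simp only [twoPointPlusEnum_succ, twoPointMinusEnum_succ, hxa, hta, Fin.cons_succ]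

/-- Access identity: `Fin.append A (Fin.cons x B)` at the word position `K.succAbove m` is the pair datum `Fin.append A B m`. -/
theorem append_cons_apply_succAbove {α : Type*} {K J : ℕ} (A : Fin K → α) (x : α) (B : Fin J → α) (m : Fin (K + J)) :
    (Fin.append (m := K) (n := J + 1) A (Fin.cons x B : Fin (J + 1) → α) : Fin (K + J + 1) → α)
        ((⟨K, Nat.lt_succ_of_le (Nat.le_add_right K J)⟩ : Fin (K + J + 1)).succAbove m) =
      Fin.append A B m := by
  refine Fin.addCases (m := K) (n := J) (fun a => ?_) (fun l => ?_) m
  · have h : ((⟨K, Nat.lt_succ_of_le (Nat.le_add_right K J)⟩ : Fin (K + J + 1)).succAbove (Fin.castAdd J a)) =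
        Fin.castAdd (J + 1) a := by
      rw [Fin.succAbove_of_castSucc_lt _ _ (by rw [Fin.lt_def]; simp)]
      exact Fin.ext (by simp)
    rw [h, Fin.append_left, Fin.append_left]
  · have h : ((⟨K, Nat.lt_succ_of_le (Nat.le_add_right K J)⟩ : Fin (K + J + 1)).succAbove (Fin.natAdd K l)) =
        Fin.natAdd K l.succ := by
      rw [Fin.succAbove_of_le_castSucc _ _ (by rw [Fin.le_def]; simp)]
      exact Fin.ext (by simp [Nat.add_assoc])
    rw [h, Fin.append_right, Fin.append_right, Fin.cons_succ]

/-- Access identity: `Fin.append A (Fin.cons x B)` at the insertion point `K` is `x`. -/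
theorem append_cons_apply_mid {α : Type*} {K J : ℕ} (A : Fin K → α) (x : α) (B : Fin J → α) :
    (Fin.append (m := K) (n := J + 1) A (Fin.cons x B : Fin (J + 1) → α) : Fin (K + J + 1) → α)
        (⟨K, Nat.lt_succ_of_le (Nat.le_add_right K J)⟩ : Fin (K + J + 1)) = x := by
  have h : ((⟨K, Nat.lt_succ_of_le (Nat.le_add_right K J)⟩ : Fin (K + J + 1))) = Fin.natAdd K (0 : Fin (J + 1)) :=
    Fin.ext (by simp)
  rw [h, Fin.append_right, Fin.cons_zero]

/-- **`Fin.append A (Fin.cons x B) = Fin.insertNth K x (Fin.append A B)`** — the block data of the two-time Dyson series as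
insertion data. -/
theorem append_cons_eq_insertNth {α : Type*} {K J : ℕ} (A : Fin K → α) (x : α) (B : Fin J → α) :
    (Fin.append (m := K) (n := J + 1) A (Fin.cons x B : Fin (J + 1) → α) : Fin (K + J + 1) → α) =
      Fin.insertNth (⟨K, Nat.lt_succ_of_le (Nat.le_add_right K J)⟩ : Fin (K + J + 1)) x (Fin.append A B) := by
  funext i
  refine Fin.succAboveCases (⟨K, Nat.lt_succ_of_le (Nat.le_add_right K J)⟩ : Fin (K + J + 1)) ?_ (fun m => ?_) i
  · rw [append_cons_apply_mid, Fin.insertNth_apply_same]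
  · rw [append_cons_apply_succAbove, Fin.insertNth_apply_succAbove]

end Summit.HubbardSuperconductivity.HubbardSuperconductivity.Theorems.TwoPointAssembly

end
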